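import Summits.Langlands.Langlands.Theses.CMFreeCompletedClosure

/-!
# `TorsionGaloisRep` — negative-lane support: the hypothesis is inhabited (degree-`0` Eisenstein
# eigensystem) and the rank-`0` sector is trivially true

Refuter findings for the crux `CMFreeCompletedClosure.TorsionGaloisRep` (stmt-Langlands-18471),
birth attack 2026-08-17.  Sorry-free; no statement of the route is asserted.

* `eigensystemOccurs_heckeDegree` / `torsionGaloisRep_hypothesis_inhabited` (**non-vacuity**): for
  EVERY number field `K`, `n`, prime `p` and tame level `𝒰 : TameLevel n K p`, the constant function
  `1 ∈ H⁰(X_{U_0}, 𝒪/p^{t+1})` (`𝒪 = 𝒪_{ℚ̄_p}`, the crux's coefficient ring) is a simultaneous Hecke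
  eigenclass with `T_{v,j} [1] = #(U_0 t_{v,j} U_0 / U_0) · [1]` (`heckeEnd_constClass`, any level,
  any coefficients) and exact annihilator `(p^{t+1})`; hence the `𝒪`-valued eigensystem
  `a v j := deg T_{v,j}` OCCURS in completed cohomology in degree `0`
  (`TameLevel.EigensystemOccurs`).  So the hypothesis of the crux is satisfiable at every
  `(E, n, ℓ, 𝒰)`, and any proof must in particular produce, for this `a`, a semisimple `ρ` with
  `charpoly ρ(Frob_v) = heckeFrobPoly n q_v (deg T_{v,·})`; for `U_0 = U` hyperspecial at `v` the
  degree is the Gaussian binomial `[n choose j]_{q_v}` (not evaluated here) and the `q`-binomial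
  theorem gives `∏_{k<n} (X - q_v^k)`, i.e. `ρ ≃ 1 ⊕ χ_ℓ ⊕ ⋯ ⊕ χ_ℓ^{n-1}` — consistent (paper check of
  the `q_v^{j(j-1)/2}` normalisation of `heckeFrobPoly`).
* `torsionGaloisRep_rank_zero` (**degenerate sector**): for `n = 0` the conclusion holds with the
  trivial representation (`heckeFrobPoly 0 q a = 1 =` charpoly of the `0 × 0` matrix), whatever the
  hypothesis — a harmless junk sector of the crux, recorded so that no one mistakes it for content.
-/

noncomputable section

set_option linter.dupNamespace false -- `Summit.Langlands.Langlands` is the mandated namespace (D-0017)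

open CategoryTheory
open scoped NumberField

namespace Summit.Langlands.Langlands.Theorems.TorsionGaloisRep.Negative

open Literature.NumberTheory.Automorphic Literature.NumberTheory.GaloisRepresentations
  IsDedekindDomain

universe u

/-! ## The constant class `[m] ∈ H⁰(X_L, M)` and the Hecke operators on it (any level, any `M`) -/

section ConstClass

variable (k : Type u) [CommRing k] {Γ 𝒢 : Type u} [Group Γ] [Group 𝒢]
variable (ι : Γ →* 𝒢) (L : Subgroup 𝒢) (M : Type u) [AddCommGroup M] [Module k M]

/-- The constant function with value `m`, as a `Γ`-invariant vector of `Fun(𝒢 ⧸ L, M)` (the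
invariance `(γ • m)(c) = m` is `ArtinWeightRealisationLevel.Negative.const_mem_invariants` of
`Theorems/ArtinWeightRealisationLevel/Negative/ZeroSector.lean`, re-proved inline so as not to
import that route). [folklore] -/
def constInvariant (m : M) : (ArithmeticQuotient.coeffRep k ι L M).ρ.invariants :=
  ⟨fun _ : 𝒢 ⧸ L => m, by
    intro γ
    ext c
    simp [ArithmeticQuotient.coeffRep]⟩

/-- Its values. [folklore] -/
@[simp] theorem coe_constInvariant_apply (m : M) (c : 𝒢 ⧸ L) :
    (constInvariant k ι L M m : (𝒢 ⧸ L) → M) c = m := rfl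

/-- The degree-`0` class `[m] ∈ H⁰(X_L, M)` of the constant function `m` (through Mathlib's
`groupCohomology.H0Iso : H⁰ ≅ invariants`). [folklore] -/
def constClass (m : M) : ArithmeticQuotient.cohomology k ι L M 0 :=
  (groupCohomology.H0Iso (ArithmeticQuotient.coeffRep k ι L M)).inv (constInvariant k ι L M m)

/-- A scalar kills `[m]` iff it kills `m`. [folklore] -/
theorem smul_constClass_eq_zero_iff (a : k) (m : M) :
    a • constClass k ι L M m = 0 ↔ a • m = 0 := by
  unfold constClass
  constructor
  · intro h
    have h1 := congrArg
      (fun x => (groupCohomology.H0Iso (ArithmeticQuotient.coeffRep k ι L M)).hom x) h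
    simp only [map_smul, map_zero] at h1
    have h2 := congrArg
      (fun f : (ArithmeticQuotient.coeffRep k ι L M).ρ.invariants =>
        (f : (𝒢 ⧸ L) → M) ((1 : 𝒢) : 𝒢 ⧸ L)) h1
    simpa using h2
  · intro h
    have h1 : a • constInvariant k ι L M m = 0 := by
      ext c
      simp [h]
    rw [← map_smul, h1, map_zero]

/-- `[m] ≠ 0` for `m ≠ 0`. [folklore] -/
theorem constClass_ne_zero {m : M} (hm : m ≠ 0) : constClass k ι L M m ≠ 0 := by
  intro h
  have := (smul_constClass_eq_zero_iff k ι L M 1 m).1 (by rw [one_smul]; exact h)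
  exact hm (by simpa using this)

/-- `T_g m = #(L g L / L) · m` on constant functions (when the double coset is finite).
[folklore] -/
theorem heckeFun_const {g : 𝒢} (hfin : (ArithmeticQuotient.doubleCosetQuot L g).Finite) (m : M) :
    ArithmeticQuotient.heckeFun k L g M (fun _ : 𝒢 ⧸ L => m) =
      fun _ => (hfin.toFinset.card : k) • m := by
  classical
  funext c
  rw [ArithmeticQuotient.heckeFun_apply, dif_pos hfin, Finset.sum_const, Nat.cast_smul_eq_nsmul]

/-- **`T_g [m] = #(L g L / L) · [m]` in `H⁰(X_L, M)`** (naturality of `H0Iso`,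
`groupCohomology.map_id_comp_H0Iso_hom`, and `heckeFun_const`). [folklore] -/
theorem heckeEnd_constClass {g : 𝒢} (hfin : (ArithmeticQuotient.doubleCosetQuot L g).Finite)
    (m : M) :
    ArithmeticQuotient.heckeEnd k L g M ι 0 (constClass k ι L M m) =
      (hfin.toFinset.card : k) • constClass k ι L M m := by
  set A := ArithmeticQuotient.coeffRep k ι L M with hA
  set e := groupCohomology.H0Iso A with he
  set x₁ : A.ρ.invariants := constInvariant k ι L M m with hx₁
  have hx : (Rep.invariantsFunctor k Γ).map (ArithmeticQuotient.heckeRepHom k L g M ι) x₁ =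
      (hfin.toFinset.card : k) • x₁ := by
    apply Subtype.ext
    change ArithmeticQuotient.heckeFun k L g M (fun _ : 𝒢 ⧸ L => m) =
      (hfin.toFinset.card : k) • fun _ => m
    rw [heckeFun_const k L M hfin]
    funext c
    simp
  have hnat := groupCohomology.map_id_comp_H0Iso_hom (ArithmeticQuotient.heckeRepHom k L g M ι)
  have h1 : e.hom (groupCohomology.map (MonoidHom.id Γ)
      (ArithmeticQuotient.heckeRepHom k L g M ι) 0 (e.inv x₁)) = (hfin.toFinset.card : k) • x₁ := by
    have h2 := ConcreteCategory.congr_hom hnat (e.inv x₁)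
    rw [ConcreteCategory.comp_apply, ConcreteCategory.comp_apply] at h2
    rw [h2]
    change (Rep.invariantsFunctor k Γ).map (ArithmeticQuotient.heckeRepHom k L g M ι)
      (e.hom (e.inv x₁)) = _
    rw [Iso.inv_hom_id_apply, hx]
  have h3 := congrArg e.inv h1
  rw [Iso.hom_inv_id_apply, map_smul] at h3
  exact h3

end ConstClass

/-! ## `𝒪 = 𝒪_{ℚ̄_p}` and `p ∉ 𝒪ˣ` -/

/-- The valuation ring `𝒪_{ℚ̄_p}` of `ℚ̄_p = PadicAlgCl p` (the coefficient ring of the crux,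
`(Valued.v : Valuation (PadicAlgCl p) NNReal).valuationSubring`). [folklore] -/
abbrev Oint (p : ℕ) [Fact p.Prime] : ValuationSubring (PadicAlgCl p) :=
  (Valued.v : Valuation (PadicAlgCl p) NNReal).valuationSubring

/-- `p` is not a unit of `𝒪_{ℚ̄_p}` (its valuation is `1/p < 1`). [folklore] -/
theorem not_isUnit_natCast_Oint (p : ℕ) [Fact p.Prime] : ¬ IsUnit ((p : ℕ) : Oint p) := by
  rintro ⟨u, hu⟩
  have h1 : ((u : Oint p) : PadicAlgCl p) * (((u⁻¹ : (Oint p)ˣ) : Oint p) : PadicAlgCl p) = 1 := by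
    rw [← Subring.coe_mul, Units.mul_inv]
    rfl
  have hv := congrArg (Valued.v : PadicAlgCl p → NNReal) h1
  rw [map_mul, map_one, hu] at hv
  have hle : Valued.v ((((u⁻¹ : (Oint p)ˣ) : Oint p) : PadicAlgCl p)) ≤ 1 :=
    ((u⁻¹ : (Oint p)ˣ) : Oint p).2
  have hp : Valued.v ((((p : ℕ) : Oint p) : PadicAlgCl p)) = 1 / (p : NNReal) := by
    rw [show ((((p : ℕ) : Oint p) : PadicAlgCl p)) = (p : PadicAlgCl p) from rfl]
    exact PadicAlgCl.valuation_p p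
  rw [hp] at hv
  have hp1 : (1 : NNReal) < p := by exact_mod_cast (Fact.out : p.Prime).one_lt
  have : (1 : NNReal) / p * Valued.v ((((u⁻¹ : (Oint p)ˣ) : Oint p) : PadicAlgCl p)) < 1 := by
    calc (1 : NNReal) / p * _ ≤ 1 / p * 1 := by gcongr
      _ < 1 := by
        rw [mul_one, one_div]
        exact inv_lt_one_of_one_lt₀ hp1
  exact absurd hv this.ne

/-- Hence `1 ≠ 0` in `𝒪/p^{t+1}`. [folklore] -/
theorem one_ne_zero_modPow (p : ℕ) [Fact p.Prime] (t : ℕ) :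
    (1 : modPow (Oint p) ((p : ℕ) : Oint p) (t + 1)) ≠ 0 := by
  intro h10
  apply not_isUnit_natCast_Oint p
  have : Ideal.span {((p : ℕ) : Oint p) ^ (t + 1)} = ⊤ := by
    rw [Ideal.eq_top_iff_one]
    exact (Ideal.Quotient.eq_zero_iff_mem).1 h10
  rw [Ideal.span_singleton_eq_top] at this
  exact (isUnit_pow_iff (Nat.succ_ne_zero t)).1 this

/-! ## The degree-`0` occurrence for `GL_n / K` -/

variable {n : ℕ} {K : Type} [Field K] [NumberField K] {p : ℕ} [Fact p.Prime]

/-- The degree of `T_{v,j}` at the bottom level `U_0` of the `p`-power tower of `𝒰`: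
`#(U_0 t_{v,j} U_0 / U_0)` (finite: `U_0` is compact open, `finite_orbit_quotient`). [folklore] -/
def heckeDegree (𝒰 : BigHeckeGLn.TameLevel n K p) (v : HeightOneSpectrum (𝓞 K)) (j : ℕ) : ℕ :=
  (finite_orbit_quotient (𝒰.tower 0) (BigHeckeGLn.heckeElement n K v j)).toFinset.card

/-- **The degree-`0` Eisenstein eigensystem occurs.**  For every tame level `𝒰` of `GL_n / K` at `p`
the `𝒪_{ℚ̄_p}`-valued system `T_{v,j} ↦ deg T_{v,j} = #(U_0 t_{v,j} U_0 / U_0)` occurs in the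
completed cohomology `H̃⁰` (`TameLevel.EigensystemOccurs`, witnessed at every stage `t` by the
constant class `[1] ∈ H⁰(X_{U_0}, 𝒪/p^{t+1})`).  In particular the hypothesis of
`CMFreeCompletedClosure.TorsionGaloisRep` is inhabited at every `(E, n, ℓ, 𝒰)`. [folklore] -/
theorem eigensystemOccurs_heckeDegree (𝒰 : BigHeckeGLn.TameLevel n K p) :
    𝒰.EigensystemOccurs (Oint p) (fun v j => ((heckeDegree 𝒰 v j : ℕ) : Oint p)) 0 := by
  intro t
  refine ⟨0, constClass (Oint p) (BigHeckeGLn.globalEmbedding n K) (𝒰.tower 0)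
      (modPow (Oint p) ((p : ℕ) : Oint p) (t + 1)) 1, ⟨?_, fun x => ?_⟩, ?_⟩
  · exact constClass_ne_zero _ _ _ _ (one_ne_zero_modPow p t)
  · exact heckeEnd_constClass (Oint p) (BigHeckeGLn.globalEmbedding n K) (𝒰.tower 0)
      (modPow (Oint p) ((p : ℕ) : Oint p) (t + 1))
      (finite_orbit_quotient (𝒰.tower 0) (BigHeckeGLn.heckeElement n K x.v x.i)) 1
  · intro b hb
    have hb' : b • constClass (Oint p) (BigHeckeGLn.globalEmbedding n K) (𝒰.tower 0)
        (modPow (Oint p) ((p : ℕ) : Oint p) (t + 1)) 1 = 0 := hb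
    rw [smul_constClass_eq_zero_iff, Algebra.smul_def, mul_one] at hb'
    exact (Ideal.Quotient.eq_zero_iff_mem).1 hb'

/-- Specialisation recorded against the crux (coefficient ring written verbatim as in the route
file): over any `E` the hypothesis of `TorsionGaloisRep` at `(E, n, ℓ, 𝒰, i = 0, a = heckeDegree 𝒰)`
holds, so the crux asserts in particular the existence of a semisimple `ρ : Γ_E → GL_n(ℚ̄_ℓ)`,
unramified outside `𝒰.bad`, with `charpoly ρ(Frob_v) = heckeFrobPoly n q_v (deg T_{v,·})` at every
`v ∉ 𝒰.bad`. [folklore] -/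
theorem torsionGaloisRep_hypothesis_inhabited {E : Type} [Field E] [NumberField E] {ℓ : ℕ}
    [Fact ℓ.Prime] (𝒰 : BigHeckeGLn.TameLevel n E ℓ) :
    𝒰.EigensystemOccurs (Valued.v : Valuation (PadicAlgCl ℓ) NNReal).valuationSubring
      (fun v j => ((heckeDegree 𝒰 v j : ℕ) :
        (Valued.v : Valuation (PadicAlgCl ℓ) NNReal).valuationSubring)) 0 :=
  eigensystemOccurs_heckeDegree 𝒰

/-! ## The rank-`0` sector holds trivially -/

section RankZero

open Polynomial

/-- `heckeFrobPoly 0 q a = 1`. [folklore] -/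
theorem heckeFrobPoly_zero {A : Type*} [Ring A] (q : ℕ) (a : ℕ → A) :
    BigHeckeGLn.heckeFrobPoly 0 q a = 1 := by
  simp [BigHeckeGLn.heckeFrobPoly]

variable (E : Type) [Field E] [NumberField E] (ℓ : ℕ) [Fact ℓ.Prime]

/-- The trivial framed representation of rank `0`. [folklore] -/
def trivRep0 : FramedGaloisRep E (PadicAlgCl ℓ) 0 := 1

omit [NumberField E] in
/-- `trivRep0` is identically `1`. [folklore] -/
theorem trivRep0_apply (σ : Field.absoluteGaloisGroup E) : trivRep0 E ℓ σ = 1 := rfl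

omit [NumberField E] in
/-- Its Frobenius (indeed every) characteristic polynomial is `1` (empty matrix). [folklore] -/
theorem charpoly_trivRep0 (σ : Field.absoluteGaloisGroup E) :
    FramedRep.charpoly (trivRep0 E ℓ) σ = 1 := by
  unfold FramedRep.charpoly
  rw [trivRep0_apply]
  simp [Matrix.charpoly]

omit [NumberField E] in
/-- It is semisimple (its subrepresentation lattice is a singleton). [folklore] -/
theorem isSemisimple_trivRep0 : (trivRep0 E ℓ).toGaloisRep.IsSemisimple := by
  change ComplementedLattice _
  refine ⟨fun W => ⟨⊥, ?_⟩⟩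
  have hW : W = ⊤ := by
    ext x
    obtain rfl : x = 0 := Subsingleton.elim x 0
    exact ⟨fun _ => Submodule.zero_mem _, fun _ => Submodule.zero_mem _⟩
  rw [hW]
  exact isCompl_top_bot

/-- **The rank-`0` sector of `TorsionGaloisRep` holds trivially** (with the trivial representation;
its hypothesis is moreover always satisfied there, `SphericalIndex 0 S` being empty). [folklore] -/
theorem torsionGaloisRep_rank_zero (𝒰 : BigHeckeGLn.TameLevel 0 E ℓ) (_i : ℕ)
    (a : HeightOneSpectrum (NumberField.RingOfIntegers E) → ℕ →
      (Valued.v : Valuation (PadicAlgCl ℓ) NNReal).valuationSubring) :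
    ∃ ρ : FramedGaloisRep E (PadicAlgCl ℓ) 0, ρ.toGaloisRep.IsSemisimple ∧
      BigHeckeGLn.IsAssociatedFamily 0 𝒰.bad
        (fun v j => ((a v j : (Valued.v : Valuation (PadicAlgCl ℓ) NNReal).valuationSubring) :
          PadicAlgCl ℓ)) ρ := by
  refine ⟨trivRep0 E ℓ, isSemisimple_trivRep0 E ℓ, fun v _ => ⟨?_, ?_⟩⟩
  · intro 𝔓 _ σ _
    exact Subsingleton.elim _ _
  · intro 𝔓 _ σ _
    rw [charpoly_trivRep0, heckeFrobPoly_zero]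

end RankZero

end Summit.Langlands.Langlands.Theorems.TorsionGaloisRep.Negative

end
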